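import Mathlib.Combinatorics.SetFamily.FourFunctions
import Mathlib.Combinatorics.SetFamily.Compression.Down
import Mathlib.Tactic
import HarnessLib
import HarnessLib.Audit.Tags
import Summits.CriticalPhenomena.PercolationContinuityZ3.Theorems.PercNearOneGluingNoHeavyLowerTailSahiRainbowStrictThree

/-!
# The rainbow lemma as a TWO-COLOURING statement: monochromatic meets of a complement-closed family

Support file (seat `prim-masterthm-p1`, gen 41; `--supports stmt-CriticalPhenomena-4575`).  No `sorry`, standard axioms.
Memo `run/shared/lean/prim/prim-masterthm/FROM-prim-masterthm-p1-g41-TWO-COLOUR.md`.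

THE REFORMULATION ([this work]).  Let `Z ⊆ 2^G` be COMPLEMENT-CLOSED (`z ∈ Z ⇒ G \ z ∈ Z`), so `#Z = 2m`, and let `Z = X ⊔ Y` be ANY
partition into two colour classes.  Write `monoMeets X Y = {∅} ∪ {x ∩ x' : x ≠ x' ∈ X} ∪ {y ∩ y' : y ≠ y' ∈ Y}` (the monochromatic
meets of distinct members, with `∅` adjoined).

* `TwoColourMeets` (typed, [status: open]): `#Z ≤ 2 · #monoMeets X Y` whenever `#Z ≥ 6` (i.e. `#monoMeets ≥ m` for `m ≥ 3`; for
  `m ≤ 2` the bound is `m - 1`, attained by two constant-coloured pairs of different colours).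
* (companion file `…SahiRainbowTwoColourEquiv`: `threeFamilyTwin_of_twoColourMeets`, `twoColourMeets_of_threeFamilyTwin`) — **this
  statement IS gen 40's three-family twin inequality `ThreeFamilyTwin` (M3♯)**: with `Q` = the members of `X` whose complement is in `Y`, `V₁` = the members of `X` whose
  complement is in `X`, `V₀` = the members of `Y` whose complement is in `Y`, one has `X = Q ⊔ V₁`, `Y = σQ ⊔ V₀` and the colour set of
  M3♯ is literally `monoMeets X Y` (co-joins of `Q ∪ V₀` = meets of `σQ ∪ V₀`).  The configuration count `5^(2^(n-1))` of the M3♯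
  census (gen 40, kit j298689: all `5^16` configurations on 5 points) is exactly the number of pairs (complement-closed `Z`,
  2-colouring): each antipodal pair `{u, G \ u}` is absent / both `X` / both `Y` / split one way / split the other way.
* `rainbowMeetCojoin_of_twoColourMeets` — the ANTIPODAL colouring (`X = 𝒜`, `Y = σ𝒜`) is the rainbow lemma: `monoMeets 𝒜 σ𝒜 =
  rainbowMeets G 𝒜` (`monoMeets_eq_rainbowMeets`).
* `card_le_card_monoMeets_const` — the CONSTANT colouring (`Y = ∅`) is PROVED: it is Marica–Schönheim (`u \ u' = u ∩ (G \ u')` is a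
  meet of two distinct members of `Z = U ⊔ σU`; Mathlib `Finset.card_le_card_diffs`).
So M3♯ interpolates between Marica–Schönheim (all pairs constant) and the rainbow lemma (all pairs split), for ARBITRARY
2-colourings of a complement-closed family.  The point of the reformulation is that it is closed under the compression of the
companion file `…SahiRainbowTwoColourStep` (the doubled sub-configuration at a point, with the UPPER colouring, is again a
2-coloured complement-closed family), which makes M3♯ its own inductive hypothesis.
HONEST FRAMING: `TwoColourMeets`, `ThreeFamilyTwin`, `RainbowMeetCojoin` remain OPEN; this file proves their equivalence /
implications and the constant-colouring face. [this work]
-/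

namespace Summit.CriticalPhenomena.PercolationContinuityZ3.Theorems.SahiColouredDaykin

open Finset
open scoped FinsetFamily

variable {α : Type*} [DecidableEq α]

/-! ### 1. Pair meets and monochromatic meets -/

/-- The meets of DISTINCT members of a family. [this work] -/
def pairMeets (X : Finset (Finset α)) : Finset (Finset α) := X.offDiag.image fun p => p.1 ∩ p.2

/-- Unpacking membership in `pairMeets`. [this work] -/
theorem mem_pairMeets {X : Finset (Finset α)} {w : Finset α} :
    w ∈ pairMeets X ↔ ∃ a ∈ X, ∃ b ∈ X, a ≠ b ∧ a ∩ b = w := by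
  unfold pairMeets
  simp only [mem_image, mem_offDiag, Prod.exists]
  constructor
  · rintro ⟨a, b, ⟨ha, hb, hab⟩, h⟩; exact ⟨a, ha, b, hb, hab, h⟩
  · rintro ⟨a, ha, b, hb, hab, h⟩; exact ⟨a, b, ⟨ha, hb, hab⟩, h⟩

/-- The meet of two distinct members is a pair meet. [this work] -/
theorem inter_mem_pairMeets {X : Finset (Finset α)} {a b : Finset α} (ha : a ∈ X) (hb : b ∈ X) (hab : a ≠ b) :
    a ∩ b ∈ pairMeets X :=
  mem_pairMeets.2 ⟨a, ha, b, hb, hab, rfl⟩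

/-- `pairMeets` is monotone. [this work] -/
theorem pairMeets_mono {X X' : Finset (Finset α)} (h : X ⊆ X') : pairMeets X ⊆ pairMeets X' := by
  intro w hw
  obtain ⟨a, ha, b, hb, hab, rfl⟩ := mem_pairMeets.1 hw
  exact inter_mem_pairMeets (h ha) (h hb) hab

/-- **Monochromatic meets** of a 2-coloured family `X ⊔ Y` (colour classes `X`, `Y`), with `∅` adjoined. [this work] -/
def monoMeets (X Y : Finset (Finset α)) : Finset (Finset α) := insert ∅ (pairMeets X ∪ pairMeets Y)

/-- Symmetry in the two colours. [this work] -/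
theorem monoMeets_comm (X Y : Finset (Finset α)) : monoMeets X Y = monoMeets Y X := by
  unfold monoMeets; rw [union_comm]

/-- `∅` is always a (conventional) monochromatic meet. [this work] -/
theorem empty_mem_monoMeets (X Y : Finset (Finset α)) : (∅ : Finset α) ∈ monoMeets X Y := mem_insert_self _ _

/-- Unpacking membership in `monoMeets`. [this work] -/
theorem mem_monoMeets {X Y : Finset (Finset α)} {w : Finset α} :
    w ∈ monoMeets X Y ↔ w = ∅ ∨ w ∈ pairMeets X ∨ w ∈ pairMeets Y := by
  unfold monoMeets; rw [mem_insert, mem_union]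

/-- The complements (in `G`) of a family of subsets of `G` have, as pair meets, exactly the complemented pair joins. [this work] -/
theorem pairMeets_image_sdiff {G : Finset α} {X : Finset (Finset α)} (hXG : ∀ x ∈ X, x ⊆ G) :
    pairMeets (X.image fun x => G \ x) = X.offDiag.image fun p => G \ (p.1 ∪ p.2) := by
  ext w
  rw [mem_pairMeets]
  simp only [mem_image, mem_offDiag, Prod.exists]
  constructor
  · rintro ⟨a', ⟨a, ha, rfl⟩, b', ⟨b, hb, rfl⟩, hab, rfl⟩
    refine ⟨a, b, ⟨ha, hb, fun h => hab (by rw [h])⟩, ?_⟩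
    ext t; simp only [mem_sdiff, mem_union, mem_inter]; tauto
  · rintro ⟨a, b, ⟨ha, hb, hab⟩, rfl⟩
    refine ⟨G \ a, ⟨a, ha, rfl⟩, G \ b, ⟨b, hb, rfl⟩, fun h => hab ?_, ?_⟩
    · rw [← Finset.sdiff_sdiff_eq_self (hXG a ha), h, Finset.sdiff_sdiff_eq_self (hXG b hb)]
    · ext t; simp only [mem_sdiff, mem_union, mem_inter]; tauto

/-- **The antipodal colouring is the rainbow lemma's colour set**: `monoMeets 𝒜 σ𝒜 = rainbowMeets G 𝒜`. [this work] -/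
theorem monoMeets_eq_rainbowMeets {G : Finset α} {𝒜 : Finset (Finset α)} (h𝒜G : ∀ a ∈ 𝒜, a ⊆ G) :
    monoMeets 𝒜 (𝒜.image fun a => G \ a) = rainbowMeets G 𝒜 := by
  unfold monoMeets rainbowMeets
  rw [pairMeets_image_sdiff h𝒜G]
  rfl

/-! ### 2. The typed statement -/

/-- **CONJECTURE (monochromatic meets of a 2-coloured complement-closed family; typed).**  For every complement-closed
`Z = X ⊔ Y ⊆ 2^G` with `#Z ≥ 6`: `#Z ≤ 2 · #monoMeets X Y`.  Equivalent to `ThreeFamilyTwin` (§3); the antipodal colouring is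
`RainbowMeetCojoin` (§4); the constant colouring is Marica–Schönheim (§5, proved).  EVIDENCE: gen 40's exhaustive M3♯ censuses
(all configurations on ≤ 5 points; `prim-masterthm-p1/certs-g40/SUMMARY.txt`) are censuses of exactly this statement
(`prim-masterthm-p1/code-g41/c/z2.c` re-verifies n ≤ 4 exhaustively and n = 5, 6 by sampling in this language).
[this work] [status: open] -/
@[conjecture] def TwoColourMeets (α : Type*) [DecidableEq α] : Prop :=
  ∀ (G : Finset α) (X Y : Finset (Finset α)),
    (∀ z ∈ X ∪ Y, z ⊆ G) → (∀ z ∈ X ∪ Y, G \ z ∈ X ∪ Y) → Disjoint X Y →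
    6 ≤ #(X ∪ Y) → #(X ∪ Y) ≤ 2 * #(monoMeets X Y)

/-! ### 3. Complement images -/

section ComplImage

variable {G : Finset α}

/-- A family closed under complement in `G` equals its own complement image. [this work] -/
theorem image_sdiff_eq_self_of_closed {V : Finset (Finset α)} (hVG : ∀ v ∈ V, v ⊆ G) (hV : ∀ v ∈ V, G \ v ∈ V) :
    V.image (fun v => G \ v) = V := by
  ext w
  simp only [mem_image]
  constructor
  · rintro ⟨v, hv, rfl⟩; exact hV v hv
  · intro hw; exact ⟨G \ w, hV w hw, Finset.sdiff_sdiff_eq_self (hVG w hw)⟩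

/-- `U ∪ σU` is closed under complement in `G` (for `U ⊆ 2^G`). [this work] -/
theorem sdiff_mem_union_image {U : Finset (Finset α)} (hUG : ∀ u ∈ U, u ⊆ G) {v : Finset α}
    (hv : v ∈ U ∪ U.image fun u => G \ u) : G \ v ∈ U ∪ U.image fun u => G \ u := by
  rcases mem_union.1 hv with hv | hv
  · exact mem_union.2 (Or.inr (mem_image.2 ⟨v, hv, rfl⟩))
  · obtain ⟨u, hu, rfl⟩ := mem_image.1 hv
    rw [Finset.sdiff_sdiff_eq_self (hUG u hu)]
    exact mem_union.2 (Or.inl hu)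

/-- Members of `U ∪ σU` lie in `G`. [this work] -/
theorem subset_of_mem_union_image {U : Finset (Finset α)} (hUG : ∀ u ∈ U, u ⊆ G) {v : Finset α}
    (hv : v ∈ U ∪ U.image fun u => G \ u) : v ⊆ G := by
  rcases mem_union.1 hv with hv | hv
  · exact hUG v hv
  · obtain ⟨u, _, rfl⟩ := mem_image.1 hv; exact sdiff_subset

/-- Cardinality of `U ∪ σU` for complement-free `U ⊆ 2^G`. [this work] -/
theorem card_union_image_sdiff {U : Finset (Finset α)} (hUG : ∀ u ∈ U, u ⊆ G) (hcf : ∀ u ∈ U, G \ u ∉ U) :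
    #(U ∪ U.image fun u => G \ u) = 2 * #U := by
  have hinj : Set.InjOn (fun u : Finset α => G \ u) U := by
    intro a ha b hb h
    have := congrArg (fun s => G \ s) h
    simpa only [Finset.sdiff_sdiff_eq_self (hUG a ha), Finset.sdiff_sdiff_eq_self (hUG b hb)] using this
  have hdisj : Disjoint U (U.image fun u => G \ u) := by
    rw [disjoint_left]
    intro a ha ha'
    obtain ⟨u, hu, hua⟩ := mem_image.1 ha'
    exact hcf u hu (hua ▸ ha)
  rw [card_union_of_disjoint hdisj, card_image_of_injOn hinj]; ring

end ComplImage

/-! ### 4. The antipodal face: the rainbow lemma -/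

/-- A complement-free pair of members has at least two rainbow meets. [this work] -/
theorem two_le_card_rainbowMeets_of_pair {G : Finset α} {𝒜 : Finset (Finset α)} (h𝒜G : ∀ a ∈ 𝒜, a ⊆ G)
    (hcf : ∀ a ∈ 𝒜, G \ a ∉ 𝒜) {a b : Finset α} (ha : a ∈ 𝒜) (hb : b ∈ 𝒜) (hab : a ≠ b) :
    2 ≤ #(rainbowMeets G 𝒜) := by
  have h1 : a ∩ b ∈ rainbowMeets G 𝒜 := inter_mem_rainbowMeets ha hb hab
  have h2 : G \ (a ∪ b) ∈ rainbowMeets G 𝒜 := sdiff_union_mem_rainbowMeets ha hb hab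
  have h0 : (∅ : Finset α) ∈ rainbowMeets G 𝒜 := mem_rainbowMeets_iff.2 (Or.inl rfl)
  -- not both colours are empty: otherwise `b = G \ a`
  have key : a ∩ b ≠ ∅ ∨ G \ (a ∪ b) ≠ ∅ := by
    by_contra hcon
    push Not at hcon
    obtain ⟨hi, hu⟩ := hcon
    apply hcf a ha
    have : G \ a = b := by
      ext t
      simp only [mem_sdiff]
      constructor
      · rintro ⟨htG, hta⟩
        by_contra htb
        have : t ∈ G \ (a ∪ b) := mem_sdiff.2 ⟨htG, by rw [mem_union, not_or]; exact ⟨hta, htb⟩⟩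
        rw [hu] at this; exact notMem_empty t this
      · intro htb
        refine ⟨h𝒜G b hb htb, fun hta => ?_⟩
        have : t ∈ a ∩ b := mem_inter.2 ⟨hta, htb⟩
        rw [hi] at this; exact notMem_empty t this
    rw [this]; exact hb
  rcases key with hne | hne
  · exact (card_le_card (insert_subset h0 (singleton_subset_iff.2 h1))).trans'
      (by rw [card_insert_of_notMem (by rwa [mem_singleton, eq_comm] ), card_singleton])
  · exact (card_le_card (insert_subset h0 (singleton_subset_iff.2 h2))).trans'
      (by rw [card_insert_of_notMem (by rwa [mem_singleton, eq_comm]), card_singleton])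

/-- **`TwoColourMeets ⟹ RainbowMeetCojoin`** (the antipodal colouring `X = 𝒜`, `Y = σ𝒜`; families with at most two members
directly). [this work] -/
theorem rainbowMeetCojoin_of_twoColourMeets (h : TwoColourMeets α) : RainbowMeetCojoin α := by
  intro G 𝒜 h𝒜G hcf
  by_cases h3 : 3 ≤ #𝒜
  · set Y := 𝒜.image fun a => G \ a with hY
    have hZG : ∀ z ∈ 𝒜 ∪ Y, z ⊆ G := by
      intro z hz
      rcases mem_union.1 hz with hz | hz
      · exact h𝒜G z hz
      · obtain ⟨a, _, rfl⟩ := mem_image.1 hz; exact sdiff_subset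
    have hcc : ∀ z ∈ 𝒜 ∪ Y, G \ z ∈ 𝒜 ∪ Y := fun z hz => sdiff_mem_union_image h𝒜G hz
    have hXY : Disjoint 𝒜 Y := by
      rw [disjoint_left]; intro a ha ha'
      obtain ⟨b, hb, hba⟩ := mem_image.1 ha'
      exact hcf b hb (hba ▸ ha)
    have cZ : #(𝒜 ∪ Y) = 2 * #𝒜 := card_union_image_sdiff h𝒜G hcf
    have := h G 𝒜 Y hZG hcc hXY (by omega)
    rw [monoMeets_eq_rainbowMeets h𝒜G, cZ] at this
    omega
  · push Not at h3
    by_cases h2 : 2 ≤ #𝒜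
    · obtain ⟨a, ha, b, hb, hab⟩ := one_lt_card.1 h2
      have := two_le_card_rainbowMeets_of_pair h𝒜G hcf ha hb hab
      omega
    · have : 0 < #(rainbowMeets G 𝒜) := card_pos.2 ⟨∅, mem_rainbowMeets_iff.2 (Or.inl rfl)⟩
      omega

/-! ### 5. The constant face: Marica–Schönheim -/

/-- **The constant colouring is Marica–Schönheim (PROVED).**  For a complement-free `U ⊆ 2^G`, the complement-closed family
`Z = U ⊔ σU` coloured with ONE colour has at least `#U = #Z / 2` monochromatic meets (with `∅`): every difference `u \ u'` is the
meet `u ∩ (G \ u')` of two distinct members of `Z`, and `#(U \\ U) ≥ #U` (Mathlib `Finset.card_le_card_diffs`). [this work] -/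
theorem card_le_card_monoMeets_const {G : Finset α} {U : Finset (Finset α)} (hUG : ∀ u ∈ U, u ⊆ G)
    (hcf : ∀ u ∈ U, G \ u ∉ U) :
    #U ≤ #(monoMeets (U ∪ U.image fun u => G \ u) ∅) := by
  refine (Finset.card_le_card_diffs U).trans (card_le_card ?_)
  intro w hw
  obtain ⟨a, ha, b, hb, rfl⟩ := Finset.mem_diffs.1 hw
  by_cases hab : a = b
  · subst hab; rw [sdiff_self]; exact empty_mem_monoMeets _ _
  · have e : a \ b = a ∩ (G \ b) := by
      ext t; simp only [mem_sdiff, mem_inter]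
      constructor
      · rintro ⟨hta, htb⟩; exact ⟨hta, hUG a ha hta, htb⟩
      · rintro ⟨hta, _, htb⟩; exact ⟨hta, htb⟩
    rw [e]
    refine mem_monoMeets.2 (Or.inr (Or.inl (inter_mem_pairMeets (mem_union_left _ ha)
      (mem_union_right _ (mem_image.2 ⟨b, hb, rfl⟩)) ?_)))
    intro h
    exact hcf b hb (h ▸ ha)

/-- The same in the normalised form of `TwoColourMeets` (`Y = ∅`, every size): `#Z ≤ 2 · #monoMeets Z ∅`. [this work] -/
theorem card_le_two_mul_card_monoMeets_const {G : Finset α} {U : Finset (Finset α)} (hUG : ∀ u ∈ U, u ⊆ G)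
    (hcf : ∀ u ∈ U, G \ u ∉ U) :
    #(U ∪ U.image fun u => G \ u) ≤ 2 * #(monoMeets (U ∪ U.image fun u => G \ u) ∅) := by
  rw [card_union_image_sdiff hUG hcf]
  have := card_le_card_monoMeets_const hUG hcf
  omega

end Summit.CriticalPhenomena.PercolationContinuityZ3.Theorems.SahiColouredDaykin
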